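import Mathlib.Algebra.Order.BigOperators.Group.Finset
import Mathlib.Algebra.BigOperators.Intervals
import Mathlib.Data.Nat.Bitwise
import Mathlib.Tactic.IntervalCases
import Literature.Computability.Complexity.ThresholdGadgets
import HarnessLib

/-!
# Iterated addition is in `TC⁰`: the bits of the sum of `N` numbers of `W` bits by
constant-depth polynomial-size threshold circuits

The classical result that the binary representation of `X₁ + ⋯ + X_N` (`Xᵢ < 2^W`, given in
binary) is computed by constant-depth, polynomial-size circuits with MAJORITY gates — ITERATED
ADDITION `ITADD ≤cd MAJ` (Vollmer 1999, §1.4.1, Thm. 1.37, whence `ITADD ∈ FTC⁰`, ibid. §5.3.3,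
PDF p. 236: "iterated addition and multiplication are in FTC⁰ (Theorems 1.37 and 1.40)"; the
constant-depth reducibilities are due to Chandra–Stockmeyer–Vishkin 1984, cf. Vollmer's
bibliographic remarks to Ch. 1) — PROVED in the tree's circuit model (`tcBasis`: unbounded fan-in
`∧, ∨, ¬` and majority gates; `acDepth` with negations free; realizability calculus
`ACVecOver` / `ACRealOver` of `ACVecOver.lean`, `ACRealizeOver.lean`).

**The construction formalised.** We do NOT follow Vollmer's route (`BCOUNT` gates, then
`LOGITADD`, Thm. 1.21); instead we generalise the carry look-ahead adder (Vollmer 1999, §1.1,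
eq. (1.1): `cᵢ = ⋁_{j<i} (g_j ∧ ⋀_{j<k<i} p_k)`, Thm. 1.15) from two summands to `N` summands by
working with STRIDES of `w` positions, `N < 2^w` [folklore]. Let `d_u = #{i | bit u of Xᵢ = 1} ≤ N`
be the column counts, so that `S = ∑ᵢ Xᵢ = ∑_u d_u 2^u`, and let
`κ_t = ⌊(∑_{u<t} d_u 2^u) / 2^t⌋ < 2^w` be the carry into position `t`; bit `t` of `S` is
`(κ_t + d_t) mod 2` (`testBit_pre`). With the WINDOW value `A_t = ∑_{t-w ≤ u < t} d_u 2^{u-(t-w)}`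
(`< N·2^w`, a weighted sum of input bits with weights `< 2^w`) one has (`carry_eq`)

  `κ_t = ⌊A_t / 2^w⌋ + b_t`,  `b_t = [t ≥ w ∧ κ_{t-w} ≥ 2^w − (A_t mod 2^w)] ∈ {0,1}`,

and unrolling this recursion along `t, t-w, t-2w, …` gives the look-ahead form (`bbit_iff`)

  `b_t ⇔ ∃ j ≥ 1, jw ≤ t ∧ GEN(t,j) ∧ ∀ 1 ≤ i < j, PROP(t,i)`,
  `GEN(t,j) = [2^w − A_{t-(j-1)w} mod 2^w ≤ ⌊A_{t-jw}/2^w⌋]`,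
  `PROP(t,i) = [⌊A_{t-iw}/2^w⌋ + 1 = 2^w − A_{t-(i-1)w} mod 2^w]`,

the analogue of eq. (1.1) with "generate"/"propagate" now predicates of window values. Since
every `A_u` (and `d_u`) is a weighted sum of the input bits with total weight `< N·2^w + 1`
(polynomial, as `2^w ≤ 4N + 4`), the one-hot codes `[A_u = α]`, `[d_u = c]` form ONE threshold
layer of depth `3` (`ThresholdGadgets.acRealOver_wsum_eq`, i.e. Vollmer's `T_r ∧ ¬T_{r+1}`), above
which `GEN`, `PROP`, the parity `[(⌊A_t/2^w⌋ + d_t) odd]`, `b_t` and finally bit `t` are `AC⁰`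
formulas of depth `6`: in total depth `9` and size polynomial in `N` and the output width
(`acVecOver_iteratedAdd`, and `ACVecOver.iteratedAdd` for numbers given by the wires of a shared
realized layer).

## Main statements

* arithmetic (`namespace ItAdd`): `pre`, `carry`, `window`, `carry_eq`, `bbit_iff`, `testBit_pre`;
* `acVecOver_iteratedAdd`: over the input variables `Fin N × Fin W` (bit `t` of `Xᵢ` at `(i,t)`),
  the map `y ↦ (bit t of ∑ᵢ Xᵢ(y))_{t < W'}` is `ACVecOver tcBasis … 9 (itAddSize N W')`;
* `ACVecOver.iteratedAdd`: the same over the output wires of a realized shared layer;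
* generic formula blocks over any basis `B ⊇ acBasis` (root namespace): `acRealOver_exists_and₂`,
  `ACRealOver.xor` (the `∀`/`∃` over a finite index type used internally are private copies of
  `acRealOver_forall_fintype` / `acRealOver_exists_fintype` of `ReadOnceAmplification.lean`).

## References

* H. Vollmer, *Introduction to Circuit Complexity* (1999), §1.1 (eq. (1.1), carry look-ahead;
  Thm. 1.15), §1.4.1 (Thm. 1.37: `ITADD ≤cd BCOUNT ≤cd MAJ`), §5.3.3, PDF p. 236 (`ITADD ∈ FTC⁰`),
  bibliographic remarks to Ch. 1 (attribution to [CSV84]).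
* A. K. Chandra, L. Stockmeyer, U. Vishkin, *Constant depth reducibility*, SIAM J. Comput. 13
  (1984) 423–439 (iterated addition and majority are constant-depth equivalent).
-/

namespace Literature.Computability.Complexity

open Finset GateList

namespace ItAdd

/-! ### Arithmetic of carries in a redundant binary representation -/

section Arith

variable (d : ℕ → ℕ) (w : ℕ)

/-- The prefix value `∑_{u<t} d_u 2^u` of a digit sequence. [folklore] -/
def pre (t : ℕ) : ℕ := ∑ u ∈ range t, d u * 2 ^ u

/-- The carry into position `t`: `⌊(∑_{u<t} d_u 2^u) / 2^t⌋` (for two summands this is the carry bit `cₜ` of Vollmer 1999, §1.1). [folklore] -/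
def carry (t : ℕ) : ℕ := pre d t / 2 ^ t

/-- The window value `A_t = ∑_{u<t, t ≤ u+w} d_u 2^{u+w-t}`: the `w` digits below position `t`,
read as a number in redundant binary (for `t < w`, all digits below `t`, scaled by `2^{w-t}`). [folklore] -/
def window (t : ℕ) : ℕ := ∑ u ∈ range t, if t ≤ u + w then d u * 2 ^ (u + w - t) else 0

/-- One more digit. [folklore] -/
theorem pre_succ (t : ℕ) : pre d (t + 1) = pre d t + d t * 2 ^ t := by
  simp [pre, Finset.sum_range_succ]

variable {d}

/-- The prefix value is bounded by the digit bound: `pre t ≤ N (2^t - 1)`, here as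
`pre t + N ≤ N 2^t`. [folklore] -/
theorem pre_add_le {N : ℕ} (hd : ∀ u, d u ≤ N) (t : ℕ) : pre d t + N ≤ N * 2 ^ t := by
  induction t with
  | zero => simp [pre]
  | succ t ih =>
    rw [pre_succ, pow_succ]
    have := hd t
    nlinarith [Nat.one_le_two_pow (n := t)]

/-- The carry is below the digit bound (`κ_t < N` for `N ≥ 1`; in general `κ_t ≤ N` and
`κ_t < 2^w` when `N < 2^w`). [folklore] -/
theorem carry_lt {N : ℕ} (hd : ∀ u, d u ≤ N) (hw : N < 2 ^ w) (t : ℕ) : carry d t < 2 ^ w := by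
  unfold carry
  have h := pre_add_le hd t
  rcases Nat.eq_zero_or_pos N with rfl | hN
  · have : pre d t = 0 := by omega
    rw [this, Nat.zero_div]; exact Nat.two_pow_pos w
  · calc pre d t / 2 ^ t < N := by
          rw [Nat.div_lt_iff_lt_mul (Nat.two_pow_pos t)]; omega
      _ < 2 ^ w := hw

/-- The carry is at most `N - 1` when `N ≥ 1` (as `carry + 1 ≤ N`), and `0` when `N = 0`. [folklore] -/
theorem carry_le {N : ℕ} (hd : ∀ u, d u ≤ N) (t : ℕ) : carry d t ≤ N - 1 ∨ N = 0 := by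
  unfold carry
  have h := pre_add_le hd t
  rcases Nat.eq_zero_or_pos N with rfl | hN
  · exact Or.inr rfl
  · left
    have : pre d t / 2 ^ t < N := by
      rw [Nat.div_lt_iff_lt_mul (Nat.two_pow_pos t)]; omega
    omega

/-- The window value is a weighted sum with total weight `≤ N (2^w - 1)`: `A_t + N ≤ N 2^w`. [folklore] -/
theorem window_add_le {N : ℕ} (hd : ∀ u, d u ≤ N) (t : ℕ) : window d w t + N ≤ N * 2 ^ w := by
  unfold window
  -- invariant: the terms below `s` plus `N` fit into `N 2^{s+w-t}`
  have key : ∀ s : ℕ, s ≤ t →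
      (∑ u ∈ range s, if t ≤ u + w then d u * 2 ^ (u + w - t) else 0) + N ≤ N * 2 ^ (s + w - t) := by
    intro s hs
    induction s with
    | zero => simpa using Nat.le_mul_of_pos_right _ (Nat.two_pow_pos _)
    | succ s ih =>
      have ih' := ih (by omega)
      rw [Finset.sum_range_succ]
      split_ifs with h
      · have hds := hd s
        have e : s + 1 + w - t = (s + w - t) + 1 := by omega
        rw [e, pow_succ]
        nlinarith [Nat.one_le_two_pow (n := s + w - t)]
      · have e : s + 1 + w - t = s + w - t := by omega
        rw [e]; simpa using ih'
  simpa using key t le_rfl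

/-- `A_t < N 2^w + 1`. [folklore] -/
theorem window_lt {N : ℕ} (hd : ∀ u, d u ≤ N) (t : ℕ) : window d w t < N * 2 ^ w + 1 := by
  have := window_add_le w hd t; omega

/-- **Window decomposition of the prefix** (`t ≥ w`): `pre t = pre (t-w) + 2^{t-w} A_t`. [folklore] -/
theorem pre_eq_of_le {t : ℕ} (ht : w ≤ t) : pre d t = pre d (t - w) + 2 ^ (t - w) * window d w t := by
  unfold pre window
  rw [Finset.mul_sum]
  have hsplit := (Finset.sum_range_add_sum_Ico (fun u => d u * 2 ^ u) (Nat.sub_le t w))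
  rw [← hsplit]
  congr 1
  rw [Finset.range_eq_Ico]
  have h0 : ∑ u ∈ Ico 0 (t - w), (2 ^ (t - w) * if t ≤ u + w then d u * 2 ^ (u + w - t) else 0) = 0 :=
    Finset.sum_eq_zero fun u hu => by
      rw [Finset.mem_Ico] at hu
      rw [if_neg (by omega), mul_zero]
  rw [← Finset.sum_Ico_consecutive _ (Nat.zero_le (t - w)) (Nat.sub_le t w), h0, zero_add]
  refine Finset.sum_congr rfl fun u hu => ?_
  rw [Finset.mem_Ico] at hu
  rw [if_pos (by omega), mul_left_comm, ← pow_add]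
  congr 2; omega

/-- For `t ≤ w` the window is the whole prefix, scaled: `2^{w-t} pre t = A_t`. [folklore] -/
theorem window_eq_of_le {t : ℕ} (ht : t ≤ w) : window d w t = 2 ^ (w - t) * pre d t := by
  unfold pre window
  rw [Finset.mul_sum]
  refine Finset.sum_congr rfl fun u hu => ?_
  rw [Finset.mem_range] at hu
  rw [if_pos (by omega), mul_left_comm, ← pow_add]
  congr 2; omega

/-- The look-ahead bit `b_t = [t ≥ w ∧ κ_{t-w} ≥ 2^w − (A_t mod 2^w)]`. [folklore] -/
def bbit (d : ℕ → ℕ) (w t : ℕ) : Bool := decide (w ≤ t ∧ 2 ^ w - window d w t % 2 ^ w ≤ carry d (t - w))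

/-- `b_t` unfolded. [folklore] -/
theorem bbit_eq_true_iff (t : ℕ) :
    bbit d w t = true ↔ w ≤ t ∧ 2 ^ w - window d w t % 2 ^ w ≤ carry d (t - w) := by
  simp [bbit]

/-- **The carry recursion with stride `w`**: `κ_t = ⌊A_t/2^w⌋ + b_t` (for digits `≤ N < 2^w`). [folklore] -/
theorem carry_eq {N : ℕ} (hd : ∀ u, d u ≤ N) (hw : N < 2 ^ w) (t : ℕ) :
    carry d t = window d w t / 2 ^ w + (bbit d w t).toNat := by
  by_cases ht : w ≤ t
  · -- `pre t = pre (t-w) + 2^{t-w} A`, `pre (t-w) = 2^{t-w} q + r`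
    have hpre := pre_eq_of_le w (d := d) ht
    unfold carry
    set q := pre d (t - w) / 2 ^ (t - w) with hq
    have hqc : carry d (t - w) = q := rfl
    set r := pre d (t - w) % 2 ^ (t - w) with hr
    have hdecomp : pre d (t - w) = 2 ^ (t - w) * q + r := (Nat.div_add_mod _ _).symm
    have hrlt : r < 2 ^ (t - w) := Nat.mod_lt _ (Nat.two_pow_pos _)
    have h1 : pre d t / 2 ^ t = (q + window d w t) / 2 ^ w := by
      rw [hpre, hdecomp, show (2 : ℕ) ^ t = 2 ^ (t - w) * 2 ^ w by rw [← pow_add]; congr 1; omega,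
        ← Nat.div_div_eq_div_mul]
      congr 1
      rw [show 2 ^ (t - w) * q + r + 2 ^ (t - w) * window d w t =
        r + 2 ^ (t - w) * (q + window d w t) by ring, Nat.add_mul_div_left _ _ (Nat.two_pow_pos _),
        Nat.div_eq_of_lt hrlt, zero_add]
    rw [h1]
    -- `q < 2^w`, so `(q + A) / 2^w = A / 2^w + [q + A % 2^w ≥ 2^w]`
    have hqlt : q < 2 ^ w := carry_lt w hd hw (t - w)
    set A := window d w t with hA
    set Y := A / 2 ^ w with hY
    set Z := A % 2 ^ w with hZ
    have hAYZ : A = 2 ^ w * Y + Z := (Nat.div_add_mod _ _).symm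
    have hZlt : Z < 2 ^ w := Nat.mod_lt _ (Nat.two_pow_pos _)
    have hb : (bbit d w t).toNat = if 2 ^ w - Z ≤ q then 1 else 0 := by
      unfold bbit
      rw [hqc, ← hA, ← hZ]
      by_cases hc : 2 ^ w - Z ≤ q
      · rw [if_pos hc]; simp only [ht, hc, and_self, decide_true, Bool.toNat_true]
      · rw [if_neg hc]; simp only [hc, and_false, decide_false, Bool.toNat_false]
    rw [hb]
    split_ifs with hc
    · -- one extra carry
      obtain ⟨u, hu⟩ := Nat.exists_eq_add_of_le hc
      have e : q + A = u + 2 ^ w * (Y + 1) := by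
        rw [hu, hAYZ]; zify [hZlt.le]; ring
      rw [e, Nat.add_mul_div_left _ _ (Nat.two_pow_pos _), Nat.div_eq_of_lt (by omega), zero_add]
    · push Not at hc
      have e : q + A = (q + Z) + 2 ^ w * Y := by rw [hAYZ]; ring
      rw [e, Nat.add_mul_div_left _ _ (Nat.two_pow_pos _), Nat.div_eq_of_lt (by omega), zero_add,
        add_zero]
  · push Not at ht
    have hwin := window_eq_of_le w (d := d) ht.le
    have hb : bbit d w t = false := by simp [bbit, Nat.not_le.2 ht]
    rw [hb, Bool.toNat_false, add_zero, hwin, carry,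
      show (2 : ℕ) ^ w = 2 ^ (w - t) * 2 ^ t by rw [← pow_add]; congr 1; omega,
      Nat.mul_div_mul_left _ _ (Nat.two_pow_pos _)]

/-- `GEN(t, j)`: a carry is generated `j` strides below `t` and saturates the stride above it:
`2^w − A_{t-(j-1)w} mod 2^w ≤ ⌊A_{t-jw} / 2^w⌋`. [folklore] -/
def gen (d : ℕ → ℕ) (w t j : ℕ) : Prop := 2 ^ w - window d w (t - (j - 1) * w) % 2 ^ w ≤ window d w (t - j * w) / 2 ^ w

/-- `PROP(t, i)`: the stride `i` strides below `t` propagates an incoming carry exactly: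
`⌊A_{t-iw}/2^w⌋ + 1 = 2^w − A_{t-(i-1)w} mod 2^w`. [folklore] -/
def prop (d : ℕ → ℕ) (w t i : ℕ) : Prop :=
  window d w (t - i * w) / 2 ^ w + 1 = 2 ^ w - window d w (t - (i - 1) * w) % 2 ^ w

/-- `GEN` is decidable. [folklore] -/
instance decGen (d : ℕ → ℕ) (w t j : ℕ) : Decidable (gen d w t j) := inferInstanceAs (Decidable (_ ≤ _))
/-- `PROP` is decidable. [folklore] -/
instance decProp (d : ℕ → ℕ) (w t i : ℕ) : Decidable (prop d w t i) := inferInstanceAs (Decidable (_ = _))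

/-- **The look-ahead formula**: `b_t ⇔ ∃ j ≥ 1, jw ≤ t ∧ GEN(t,j) ∧ ∀ 1 ≤ i < j, PROP(t,i)` — the stride-`w` analogue of the carry look-ahead identity `cᵢ = ⋁_{j<i} (g_j ∧ ⋀_{j<k<i} p_k)`. [cite: Vollmer1999, §1.1, eq. (1.1) (two summands); stride form folklore] -/
theorem bbit_iff {N : ℕ} (hd : ∀ u, d u ≤ N) (hw : N < 2 ^ w) (hw0 : 0 < w) (t : ℕ) :
    bbit d w t = true ↔
      ∃ j, 1 ≤ j ∧ j * w ≤ t ∧ gen d w t j ∧ ∀ i, 1 ≤ i → i < j → prop d w t i := by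
  induction t using Nat.strong_induction_on with
  | _ t ih =>
    by_cases ht : w ≤ t
    · -- unfold one stride
      have hrec := ih (t - w) (by omega)
      have hstep : bbit d w t = true ↔ gen d w t 1 ∨ (prop d w t 1 ∧ bbit d w (t - w) = true) := by
        rw [bbit_eq_true_iff, carry_eq w hd hw (t - w)]
        simp only [gen, prop, Nat.sub_self, zero_mul, Nat.sub_zero, one_mul]
        constructor
        · rintro ⟨-, h⟩
          cases hb : bbit d w (t - w)
          · rw [hb, Bool.toNat_false, add_zero] at h; exact Or.inl h
          · rw [hb, Bool.toNat_true] at h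
            by_cases hg : 2 ^ w - window d w t % 2 ^ w ≤ window d w (t - w) / 2 ^ w
            · exact Or.inl hg
            · exact Or.inr ⟨by omega, rfl⟩
        · rintro (h | ⟨h, hb⟩)
          · exact ⟨ht, h.trans (Nat.le_add_right _ _)⟩
          · rw [hb]; exact ⟨ht, by simp; omega⟩
      rw [hstep, hrec]
      -- reindex the strides: conditions at `t - w` with index `j'` are those at `t` with `j'+1`
      have hsub : ∀ k, t - w - k * w = t - (k + 1) * w := fun k => by
        rw [Nat.sub_sub, add_mul, one_mul, add_comm]
      have hgen : ∀ j', 1 ≤ j' → (gen d w (t - w) j' ↔ gen d w t (j' + 1)) := by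
        intro j' hj'
        simp only [gen, hsub, Nat.add_sub_cancel]
        rw [show j' - 1 + 1 = j' by omega]
      have hprop : ∀ i, 1 ≤ i → (prop d w (t - w) i ↔ prop d w t (i + 1)) := by
        intro i hi
        simp only [prop, hsub, Nat.add_sub_cancel]
        rw [show i - 1 + 1 = i by omega]
      constructor
      · rintro (h | ⟨hp, j', hj', hjw, hg, hall⟩)
        · exact ⟨1, le_rfl, by omega, h, fun i hi hij => by omega⟩
        · refine ⟨j' + 1, by omega, by rw [Nat.succ_mul]; omega, (hgen j' hj').1 hg, fun i hi hij => ?_⟩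
          rcases Nat.eq_or_lt_of_le hi with rfl | hi1
          · exact hp
          · have := (hprop (i - 1) (by omega)).1 (hall (i - 1) (by omega) (by omega))
            rwa [show i - 1 + 1 = i by omega] at this
      · rintro ⟨j, hj, hjw, hg, hall⟩
        rcases Nat.eq_or_lt_of_le hj with rfl | hj1
        · exact Or.inl hg
        · refine Or.inr ⟨hall 1 le_rfl hj1, j - 1, by omega, ?_, ?_, fun i hi hij => ?_⟩
          · have : (j - 1) * w + w = j * w := by
              rw [← Nat.succ_mul]; congr 1; omega
            omega
          · have := (hgen (j - 1) (by omega)).2; rw [show j - 1 + 1 = j by omega] at this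
            exact this hg
          · exact (hprop i hi).2 (hall (i + 1) (by omega) (by omega))
    · push Not at ht
      have hb : bbit d w t = false := by simp [bbit, Nat.not_le.2 ht]
      rw [hb]
      simp only [Bool.false_eq_true, false_iff, not_exists, not_and]
      intro j hj hjw
      exfalso
      have : w ≤ j * w := Nat.le_mul_of_pos_left _ hj
      omega

/-- **The output bits**: for `t < T`, bit `t` of `pre T` is `(κ_t + d_t) mod 2` (cf. `sᵢ = aᵢ ⊕ bᵢ ⊕ cᵢ` for two summands). [cite: Vollmer1999, §1.1 (sum bits from carries); folklore] -/
theorem testBit_pre {t T : ℕ} (htT : t < T) :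
    (pre d T).testBit t = decide ((carry d t + d t) % 2 = 1) := by
  -- `pre T = pre t + 2^t (d t + 2 M)`
  set M := ∑ u ∈ Ico (t + 1) T, d u * 2 ^ (u - (t + 1)) with hM
  have hIco : ∑ u ∈ Ico (t + 1) T, d u * 2 ^ u = 2 ^ (t + 1) * M := by
    rw [hM, Finset.mul_sum]
    refine Finset.sum_congr rfl fun u hu => ?_
    rw [Finset.mem_Ico] at hu
    rw [mul_left_comm, ← pow_add]
    congr 2; omega
  have hsplit : pre d T = pre d t + 2 ^ t * (d t + 2 * M) := by
    unfold pre
    rw [← Finset.sum_range_add_sum_Ico _ (show t + 1 ≤ T from htT), Finset.sum_range_succ, hIco,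
      pow_succ]
    ring
  rw [Nat.testBit_eq_decide_div_mod_eq, hsplit, carry, Nat.add_mul_div_left _ _ (Nat.two_pow_pos t)]
  congr 1
  simp only [eq_iff_iff]
  constructor <;> intro h <;> omega

end Arith

/-! ### The column counts of a family of numbers given in binary -/

section Columns

variable {N W : ℕ}

/-- The column count `d_u = #{i | bit u of Xᵢ}` of the input bits `y (i, u)` (zero beyond `W`) — the numbers `s_k` of Vollmer's proof. [cite: Vollmer1999, §1.4.1, proof of Thm. 1.37] -/
def col (y : Fin N × Fin W → Bool) (u : ℕ) : ℕ :=
  if h : u < W then #{i : Fin N | y (i, ⟨u, h⟩) = true} else 0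

/-- Column counts are at most `N`. [folklore] -/
theorem col_le (y : Fin N × Fin W → Bool) (u : ℕ) : col y u ≤ N := by
  unfold col
  split_ifs
  · exact (Finset.card_filter_le _ _).trans (by simp)
  · exact Nat.zero_le _

/-- The value of the `i`-th number. [folklore] -/
def val (y : Fin N × Fin W → Bool) (i : Fin N) : ℕ := ∑ t : Fin W, (y (i, t)).toNat * 2 ^ (t : ℕ)

/-- The sum of the numbers. [folklore] -/
def total (y : Fin N × Fin W → Bool) : ℕ := ∑ i, val y i

/-- **The sum is the prefix value of the column counts**: `∑ᵢ Xᵢ = ∑_{u<W} d_u 2^u`. [cite: Vollmer1999, §1.4.1, proof of Thm. 1.37] -/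
theorem total_eq_pre (y : Fin N × Fin W → Bool) : total y = pre (col y) W := by
  unfold total val pre
  rw [Finset.sum_comm, ← Fin.sum_univ_eq_sum_range]
  refine Finset.sum_congr rfl fun t _ => ?_
  rw [← Finset.sum_mul]
  congr 1
  unfold col
  rw [dif_pos t.2, Finset.card_filter]
  refine Finset.sum_congr rfl fun i _ => ?_
  cases y (i, t) <;> simp

/-- Beyond `W` the prefix value is the total. [folklore] -/
theorem pre_col_of_le (y : Fin N × Fin W → Bool) {T : ℕ} (hT : W ≤ T) : pre (col y) T = total y := by
  rw [total_eq_pre]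
  unfold pre
  rw [← Finset.sum_range_add_sum_Ico _ hT]
  simp only [add_eq_left]
  refine Finset.sum_eq_zero fun u hu => ?_
  rw [Finset.mem_Ico] at hu
  simp [col, Nat.not_lt.2 hu.1]

/-- The window value as a weighted sum of the input bits: weight `2^{u+w-t}` on bit `(i,u)` for
`u` in the window below `t`. [folklore] -/
def windowWt (w t : ℕ) (p : Fin N × Fin W) : ℕ :=
  if (p.2 : ℕ) < t ∧ t ≤ p.2 + w then 2 ^ ((p.2 : ℕ) + w - t) else 0

/-- The column count as a weighted sum of the input bits: weight `1` on column `u`. [folklore] -/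
def colWt (u : ℕ) (p : Fin N × Fin W) : ℕ := if (p.2 : ℕ) = u then 1 else 0

/-- Column counts vanish beyond `W`. [folklore] -/
theorem col_of_le (y : Fin N × Fin W → Bool) {u : ℕ} (hu : W ≤ u) : col y u = 0 := by
  simp [col, Nat.not_lt.2 hu]

/-- The column count as a sum of bits. [folklore] -/
theorem col_eq_sum (y : Fin N × Fin W → Bool) (u : Fin W) :
    col y u = ∑ i : Fin N, (y (i, u)).toNat := by
  unfold col
  rw [dif_pos u.2, Finset.card_filter]
  refine Finset.sum_congr rfl fun i _ => ?_
  cases y (i, u) <;> simp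

/-- `wsum (windowWt w t) y = A_t`. [folklore] -/
theorem wsum_windowWt (w t : ℕ) (y : Fin N × Fin W → Bool) :
    wsum (windowWt w t) y = window (col y) w t := by
  -- a common integrand on `ℕ`, vanishing outside `u < t` and `u < W`
  let g : ℕ → ℕ := fun u => if u < t ∧ t ≤ u + w then col y u * 2 ^ (u + w - t) else 0
  have hg_of_le : ∀ u, W ≤ u → g u = 0 := fun u hu => by simp [g, col_of_le y hu]
  -- the left-hand side
  have hL : wsum (windowWt w t) y = ∑ u ∈ range W, g u := by
    unfold wsum
    rw [Fintype.sum_prod_type_right, ← Fin.sum_univ_eq_sum_range]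
    refine Finset.sum_congr rfl fun u _ => ?_
    by_cases h : (u : ℕ) < t ∧ t ≤ u + w
    · simp only [windowWt, h, and_self, if_true, g]
      rw [← Finset.mul_sum, mul_comm, col_eq_sum]
    · simp only [windowWt, h, if_false, zero_mul, Finset.sum_const_zero, g]
  -- the right-hand side
  have hR : window (col y) w t = ∑ u ∈ range t, g u := by
    unfold window
    refine Finset.sum_congr rfl fun u hu => ?_
    rw [Finset.mem_range] at hu
    simp [g, hu]
  -- both are the sum over `range (t + W)`
  have hgt : ∀ u, t ≤ u → g u = 0 := fun u hu => by simp [g, Nat.not_lt.2 hu]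
  rw [hL, hR, Finset.sum_subset (Finset.range_subset_range.2 (Nat.le_add_left W t)) fun u hu hu' => ?_,
    Finset.sum_subset (Finset.range_subset_range.2 (Nat.le_add_right t W)) fun u hu hu' => ?_]
  · rw [Finset.mem_range, not_lt] at hu'; exact hgt u hu'
  · rw [Finset.mem_range, not_lt] at hu'; exact hg_of_le u hu'

/-- `wsum (colWt u) y = d_u`. [folklore] -/
theorem wsum_colWt (u : ℕ) (y : Fin N × Fin W → Bool) : wsum (colWt u) y = col y u := by
  unfold wsum col
  rw [Fintype.sum_prod_type_right]
  by_cases hu : u < W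
  · rw [dif_pos hu, Finset.card_filter, Finset.sum_eq_single (⟨u, hu⟩ : Fin W)]
    · refine Finset.sum_congr rfl fun i _ => ?_
      simp only [colWt, if_true]
      cases y (i, ⟨u, hu⟩) <;> simp
    · intro v _ hv
      have : (v : ℕ) ≠ u := fun h => hv (Fin.ext h)
      simp [colWt, this]
    · simp
  · rw [dif_neg hu]
    refine Finset.sum_eq_zero fun v _ => ?_
    have : (v : ℕ) ≠ u := fun h => hu (h ▸ v.2)
    simp [colWt, this]

/-- Total weight of the window weights: `< N 2^w + 1`. [folklore] -/
theorem sum_windowWt_lt (w t : ℕ) : (∑ p : Fin N × Fin W, windowWt w t p) < N * 2 ^ w + 1 := by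
  have h := wsum_windowWt w t (fun _ : Fin N × Fin W => true)
  have hws : wsum (windowWt w t) (fun _ : Fin N × Fin W => true) = ∑ p : Fin N × Fin W, windowWt w t p := by
    simp [wsum]
  rw [← hws, h]
  exact window_lt w (col_le _) t

/-- Total weight of the column weights: `< N + 1`. [folklore] -/
theorem sum_colWt_lt (u : ℕ) : (∑ p : Fin N × Fin W, colWt u p) < N + 1 := by
  have h := wsum_colWt u (fun _ : Fin N × Fin W => true)
  have hws : wsum (colWt u) (fun _ : Fin N × Fin W => true) = ∑ p : Fin N × Fin W, colWt u p := by
    simp [wsum]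
  rw [← hws, h]
  exact Nat.lt_succ_of_le (col_le _ u)

end Columns

/-! ### The circuits -/

section Circuit

/-- The stride `w = size N + 1`: `N < 2^w`, `w ≥ 1`, `2^w ≤ 4N + 4`. [folklore] -/
def stride (N : ℕ) : ℕ := Nat.size N + 1

/-- `N < 2^w`. [folklore] -/
theorem lt_two_pow_stride (N : ℕ) : N < 2 ^ stride N := by
  unfold stride
  have := Nat.lt_size_self N
  rw [pow_succ]; omega

/-- `0 < w`. [folklore] -/
theorem stride_pos (N : ℕ) : 0 < stride N := Nat.succ_pos _

/-- `2^w ≤ 4N + 4` (so all ranges below are polynomial in `N`). [folklore] -/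
theorem two_pow_stride_le (N : ℕ) : 2 ^ stride N ≤ 4 * N + 4 := by
  unfold stride
  rw [pow_succ]
  rcases Nat.eq_zero_or_pos (Nat.size N) with h0 | hpos
  · rw [h0]; omega
  · have h := Nat.lt_size.1 (show Nat.size N - 1 < Nat.size N by omega)
    have e : 2 ^ Nat.size N = 2 * 2 ^ (Nat.size N - 1) := by
      rw [← pow_succ']; congr 1; omega
    rw [e]; omega

/-- The common range of the one-hot codes: window values and column counts are `< R`. [folklore] -/
def R (N : ℕ) : ℕ := N * 2 ^ stride N + 1

/-- `R ≤ 4N² + 4N + 1`. [folklore] -/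
theorem R_le (N : ℕ) : R N ≤ 4 * N * N + 4 * N + 1 := by
  unfold R
  have := two_pow_stride_le N
  nlinarith

/-- The weights of the first layer: column weights (`true`) or window weights (`false`). [folklore] -/
def wt (N W : ℕ) {W' : ℕ} (bu : Bool × Fin W') : Fin N × Fin W → ℕ :=
  if bu.1 then colWt bu.2 else windowWt (stride N) bu.2

/-- Their total is `< R`. [folklore] -/
theorem sum_wt_lt (N W : ℕ) {W' : ℕ} (bu : Bool × Fin W') : (∑ p : Fin N × Fin W, wt N W bu p) < R N := by
  unfold wt R
  split_ifs
  · refine (sum_colWt_lt _).trans_le ?_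
    have := Nat.two_pow_pos (stride N)
    nlinarith
  · exact sum_windowWt_lt _ _

/-- **The first (threshold) layer**: the one-hot codes `[d_u = v]` (index `(true, u, v)`) and
`[A_u = v]` (index `(false, u, v)`) for all output positions `u < W'` and values `v < R`. [folklore] -/
def l1 (N W W' : ℕ) (y : Fin N × Fin W → Bool) (k : Bool × Fin W' × Fin (R N)) : Bool :=
  decide (wsum (wt N W (k.1, k.2.1)) y = k.2.2)

/-- Semantics of the first layer: column counts … [folklore] -/
theorem l1_true {N W W' : ℕ} (y : Fin N × Fin W → Bool) (u : Fin W') (v : Fin (R N)) :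
    l1 N W W' y (true, u, v) = decide (col y u = v) := by
  simp [l1, wt, wsum_colWt]

/-- … and window values. [folklore] -/
theorem l1_false {N W W' : ℕ} (y : Fin N × Fin W → Bool) (u : Fin W') (v : Fin (R N)) :
    l1 N W W' y (false, u, v) = decide (window (col y) (stride N) u = v) := by
  simp [l1, wt, wsum_windowWt]

/-- The size of one block of the first layer. [folklore] -/
def l1Blk (N : ℕ) : ℕ := 4 * (R N + R N) + 11

/-- **Realization of the first layer**: depth `3`, `2 W' R · l1Blk` gates (exact values of weighted sums as `T_r ∧ ¬T_{r+1}`). [cite: Vollmer1999, §1.4.1, proof of Thm. 1.37] -/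
theorem acVecOver_l1 (N W W' : ℕ) : ACVecOver tcBasis (l1 N W W') 3
    (Fintype.card (Bool × Fin W' × Fin (R N)) * l1Blk N) := by
  refine acVecOver_ofBlocks_fintype_const (f := fun k y => l1 N W W' y k) fun k => ?_
  obtain ⟨b, u, v⟩ := k
  refine ((acRealOver_wsum_eq (wt N W (b, u)) v).congr fun y => rfl).mono le_rfl ?_
  unfold l1Blk
  have h1 := sum_wt_lt N W (b, u)
  have h2 := v.2
  omega

/-! #### Generic formula blocks over a layer of wires -/

section Formula

variable {ι : Type*} {B : Set GateFn} (hB : acBasis ⊆ B)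
include hB

/-- Conjunction over a finite index type, uniform size (a private copy of the lemma of the same
name in `ReadOnceAmplification.lean`, to keep the imports of this file light). [cite: Vollmer1999, §1.2] -/
private theorem acRealOver_forall_fintype {κ : Type*} [Fintype κ] {f : κ → (ι → Bool) → Bool} {d s : ℕ}
    (h : ∀ k, ACRealOver B (f k) d s) :
    ACRealOver B (fun x => decide (∀ k, f k x = true)) (d + 1) (Fintype.card κ * s + 1) := by
  have h' : ∀ j : Fin (Fintype.card κ), ACRealOver B (f ((Fintype.equivFin κ).symm j)) d s :=
    fun j => h _
  refine (acRealOver_forall_const hB h').congr fun x => ?_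
  simp only [decide_eq_decide]
  exact ⟨fun H k => by simpa using H (Fintype.equivFin κ k), fun H j => H _⟩

/-- Disjunction over a finite index type, uniform size (a private copy of the lemma of the same
name in `ReadOnceAmplification.lean`). [cite: Vollmer1999, §1.2] -/
private theorem acRealOver_exists_fintype {κ : Type*} [Fintype κ] {f : κ → (ι → Bool) → Bool} {d s : ℕ}
    (h : ∀ k, ACRealOver B (f k) d s) :
    ACRealOver B (fun x => decide (∃ k, f k x = true)) (d + 1) (Fintype.card κ * s + 1) := by
  have h' : ∀ j : Fin (Fintype.card κ), ACRealOver B (f ((Fintype.equivFin κ).symm j)) d s :=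
    fun j => h _
  refine (acRealOver_exists_const hB h').congr fun x => ?_
  simp only [decide_eq_decide]
  exact ⟨fun ⟨j, hj⟩ => ⟨_, hj⟩, fun ⟨k, hk⟩ => ⟨Fintype.equivFin κ k, by simpa using hk⟩⟩

/-- **An `∨` of `∧`s of two wires**: `[∃ v, z (a v) ∧ z (b v)]` is realized at depth `2` with
`card V + 1` gates. [cite: Vollmer1999, §1.2] -/
theorem _root_.Literature.Computability.Complexity.acRealOver_exists_and₂ {V : Type*} [Fintype V] (a b : V → ι) :
    ACRealOver B (fun z : ι → Bool => decide (∃ v, z (a v) = true ∧ z (b v) = true)) 2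
      (Fintype.card V * 1 + 1) := by
  have hblk : ∀ v, ACRealOver B (fun z : ι → Bool => decide (∀ k : Fin 2, ![z (a v), z (b v)] k = true))
      1 (2 * 0 + 1) := fun v =>
    acRealOver_forall_const hB (f := fun (k : Fin 2) (z : ι → Bool) => ![z (a v), z (b v)] k)
      fun k => by
        fin_cases k
        · exact acRealOver_input B (a v)
        · exact acRealOver_input B (b v)
  refine (acRealOver_exists_fintype hB hblk).congr fun z => ?_
  simp [Fin.forall_fin_two]

/-- Exclusive or of two realized functions (depth `+ 2`, via `(f ∧ ¬g) ∨ (¬f ∧ g)`). [cite: Vollmer1999, §1.2] -/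
theorem _root_.Literature.Computability.Complexity.ACRealOver.xor (hnot : GateFn.not ∈ B) {f g : (ι → Bool) → Bool} {d s : ℕ}
    (hf : ACRealOver B f d s) (hg : ACRealOver B g d s) :
    ACRealOver B (fun x => (f x ^^ g x)) (d + 2) (2 * (2 * (s + 1) + 1) + 1) := by
  -- the four literals, all of size `≤ s + 1`
  have lf : ACRealOver B f d (s + 1) := hf.mono le_rfl (Nat.le_succ _)
  have lg : ACRealOver B g d (s + 1) := hg.mono le_rfl (Nat.le_succ _)
  have nf : ACRealOver B (fun x => !f x) d (s + 1) := hf.neg hnot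
  have ng : ACRealOver B (fun x => !g x) d (s + 1) := hg.neg hnot
  have c1 : ACRealOver B (fun x => decide (∀ k : Fin 2, ![f x, !g x] k = true)) (d + 1) (2 * (s + 1) + 1) :=
    acRealOver_forall_const hB (f := fun (k : Fin 2) x => ![f x, !g x] k) fun k => by
      fin_cases k
      · exact lf
      · exact ng
  have c2 : ACRealOver B (fun x => decide (∀ k : Fin 2, ![!f x, g x] k = true)) (d + 1) (2 * (s + 1) + 1) :=
    acRealOver_forall_const hB (f := fun (k : Fin 2) x => ![!f x, g x] k) fun k => by
      fin_cases k
      · exact nf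
      · exact lg
  have h := acRealOver_exists_const hB
    (f := fun (k : Fin 2) x => ![decide (∀ k : Fin 2, ![f x, !g x] k = true),
      decide (∀ k : Fin 2, ![!f x, g x] k = true)] k) (fun k => by
      fin_cases k
      · exact c1
      · exact c2)
  refine h.congr fun x => ?_
  cases f x <;> cases g x <;> simp [Fin.exists_fin_two, Fin.forall_fin_two]

end Formula

/-! #### Semantics helpers: reading arithmetic predicates off one-hot codes -/

/-- A predicate of two coded values, read off their one-hot codes. [folklore] -/
theorem exists_pair_code_iff {Rg : ℕ} (P : ℕ → ℕ → Prop) {m m' : ℕ} (hm : m < Rg) (hm' : m' < Rg) :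
    (∃ pr : {pr : Fin Rg × Fin Rg // P pr.1 pr.2},
      decide (m = pr.1.1) = true ∧ decide (m' = pr.1.2) = true) ↔ P m m' := by
  constructor
  · rintro ⟨⟨⟨α, α'⟩, hP⟩, h1, h2⟩
    simp only [decide_eq_true_eq] at h1 h2
    simp only at hP
    rw [h1, h2]; exact hP
  · intro hP
    exact ⟨⟨(⟨m, hm⟩, ⟨m', hm'⟩), hP⟩, by simp, by simp⟩

/-! #### The look-ahead formulas over the first layer -/

section LookAhead

/-- Window values are `< R`. [folklore] -/
theorem window_col_lt {N W : ℕ} (y : Fin N × Fin W → Bool) (u : ℕ) :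
    window (col y) (stride N) u < R N :=
  window_lt _ (col_le y) u

/-- Column counts are `< R`. [folklore] -/
theorem col_lt_R {N W : ℕ} (y : Fin N × Fin W → Bool) (u : ℕ) : col y u < R N := by
  refine (Nat.lt_succ_of_le (col_le y u)).trans_le ?_
  unfold R
  have := Nat.two_pow_pos (stride N)
  nlinarith

/-- The position `t - k·w` as an output position. [folklore] -/
def pos (N : ℕ) {W' : ℕ} (t : Fin W') (k : ℕ) : Fin W' :=
  ⟨t - k * stride N, lt_of_le_of_lt (Nat.sub_le _ _) t.2⟩

/-- `GEN(t,j)` as a predicate of the two window values. [folklore] -/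
def genP (N α α' : ℕ) : Prop := 2 ^ stride N - α' % 2 ^ stride N ≤ α / 2 ^ stride N

/-- `PROP(t,i)` as a predicate of the two window values. [folklore] -/
def propP (N α α' : ℕ) : Prop := α / 2 ^ stride N + 1 = 2 ^ stride N - α' % 2 ^ stride N

/-- The parity `[(⌊A_t/2^w⌋ + d_t) odd]` as a predicate of the window value and the column count. [folklore] -/
def parP (N α c : ℕ) : Prop := (α / 2 ^ stride N + c) % 2 = 1

/-- `genP` is decidable. [folklore] -/
instance decGenP (N α α' : ℕ) : Decidable (genP N α α') := inferInstanceAs (Decidable (_ ≤ _))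
/-- `propP` is decidable. [folklore] -/
instance decPropP (N α α' : ℕ) : Decidable (propP N α α') := inferInstanceAs (Decidable (_ = _))
/-- `parP` is decidable. [folklore] -/
instance decParP (N α c : ℕ) : Decidable (parP N α c) := inferInstanceAs (Decidable (_ = _))

/-- The `GEN(t,j)` formula over the first-layer wires. [folklore] -/
def gF (N : ℕ) {W' : ℕ} (t : Fin W') (j : ℕ) (z : Bool × Fin W' × Fin (R N) → Bool) : Bool :=
  decide (∃ pr : {pr : Fin (R N) × Fin (R N) // genP N pr.1 pr.2},
    z (false, pos N t j, pr.1.1) = true ∧ z (false, pos N t (j - 1), pr.1.2) = true)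

/-- The `PROP(t,i)` formula over the first-layer wires. [folklore] -/
def pF (N : ℕ) {W' : ℕ} (t : Fin W') (i : ℕ) (z : Bool × Fin W' × Fin (R N) → Bool) : Bool :=
  decide (∃ pr : {pr : Fin (R N) × Fin (R N) // propP N pr.1 pr.2},
    z (false, pos N t i, pr.1.1) = true ∧ z (false, pos N t (i - 1), pr.1.2) = true)

/-- The parity formula over the first-layer wires. [folklore] -/
def qF (N : ℕ) {W' : ℕ} (t : Fin W') (z : Bool × Fin W' × Fin (R N) → Bool) : Bool :=
  decide (∃ pr : {pr : Fin (R N) × Fin (R N) // parP N pr.1 pr.2},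
    z (false, t, pr.1.1) = true ∧ z (true, t, pr.1.2) = true)

/-- Semantics of `gF`. [folklore] -/
theorem gF_l1 {N W W' : ℕ} (y : Fin N × Fin W → Bool) (t : Fin W') (j : ℕ) :
    gF N t j (l1 N W W' y) = decide (gen (col y) (stride N) t j) := by
  unfold gF
  simp only [l1_false]
  rw [decide_eq_decide]
  exact exists_pair_code_iff (genP N) (window_col_lt y _) (window_col_lt y _)

/-- Semantics of `pF`. [folklore] -/
theorem pF_l1 {N W W' : ℕ} (y : Fin N × Fin W → Bool) (t : Fin W') (i : ℕ) :
    pF N t i (l1 N W W' y) = decide (prop (col y) (stride N) t i) := by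
  unfold pF
  simp only [l1_false]
  rw [decide_eq_decide]
  exact exists_pair_code_iff (propP N) (window_col_lt y _) (window_col_lt y _)

/-- Semantics of `qF`. [folklore] -/
theorem qF_l1 {N W W' : ℕ} (y : Fin N × Fin W → Bool) (t : Fin W') :
    qF N t (l1 N W W' y) =
      decide ((window (col y) (stride N) t / 2 ^ stride N + col y t) % 2 = 1) := by
  unfold qF
  simp only [l1_false, l1_true]
  rw [decide_eq_decide]
  exact exists_pair_code_iff (parP N) (window_col_lt y _) (col_lt_R y _)

/-- The admissible stride counts `j` at position `t`: `1 ≤ j`, `jw ≤ t`. [folklore] -/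
def JT (N : ℕ) {W' : ℕ} (t : Fin W') : Type := {j : Fin (W' + 1) // 1 ≤ (j : ℕ) ∧ (j : ℕ) * stride N ≤ t}

/-- The strides strictly between: `1 ≤ i < j`. [folklore] -/
def IT {W' : ℕ} (j : Fin (W' + 1)) : Type := {i : Fin (W' + 1) // 1 ≤ (i : ℕ) ∧ i < j}

/-- `JT` is a finite type. [folklore] -/
instance fintypeJT (N : ℕ) {W' : ℕ} (t : Fin W') : Fintype (JT N t) := by unfold JT; infer_instance
/-- `IT` is a finite type. [folklore] -/
instance fintypeIT {W' : ℕ} (j : Fin (W' + 1)) : Fintype (IT j) := by unfold IT; infer_instance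

/-- The conjunct family of one look-ahead term: `GEN(t,j)` and the `PROP(t,i)`, `1 ≤ i < j`. [folklore] -/
def termF (N : ℕ) {W' : ℕ} (t : Fin W') (j : Fin (W' + 1)) :
    Option (IT j) → (Bool × Fin W' × Fin (R N) → Bool) → Bool
  | none => gF N t j
  | some i => pF N t i.1

/-- The look-ahead formula `b_t` over the first-layer wires. [folklore] -/
def bF (N : ℕ) {W' : ℕ} (t : Fin W') (z : Bool × Fin W' × Fin (R N) → Bool) : Bool :=
  decide (∃ j : JT N t, decide (∀ o : Option (IT j.1), termF N t j.1 o z = true) = true)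

/-- Cardinality bounds. [folklore] -/
theorem card_JT_le (N : ℕ) {W' : ℕ} (t : Fin W') : Fintype.card (JT N t) ≤ W' + 1 :=
  (Fintype.card_subtype_le _).trans (by simp)

/-- Cardinality bounds. [folklore] -/
theorem card_option_IT_le {W' : ℕ} (j : Fin (W' + 1)) : Fintype.card (Option (IT j)) ≤ W' + 2 := by
  rw [Fintype.card_option]
  have : Fintype.card (IT j) ≤ W' + 1 := (Fintype.card_subtype_le _).trans (by simp)
  omega

/-- Semantics of one look-ahead term. [folklore] -/
theorem termF_l1 {N W W' : ℕ} (y : Fin N × Fin W → Bool) (t : Fin W') (j : Fin (W' + 1)) :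
    (∀ o : Option (IT j), termF N t j o (l1 N W W' y) = true) ↔
      gen (col y) (stride N) t j ∧ ∀ i : IT j, prop (col y) (stride N) t i.1 := by
  constructor
  · intro h
    refine ⟨?_, fun i => ?_⟩
    · have := h none
      rwa [termF, gF_l1, decide_eq_true_eq] at this
    · have := h (some i)
      rwa [termF, pF_l1, decide_eq_true_eq] at this
  · rintro ⟨hg, hp⟩ (_ | i)
    · rw [termF, gF_l1, decide_eq_true_eq]; exact hg
    · rw [termF, pF_l1, decide_eq_true_eq]; exact hp i

/-- **Semantics of the look-ahead formula**: `bF t (l1 y) = b_t`. [folklore] -/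
theorem bF_l1 {N W W' : ℕ} (y : Fin N × Fin W → Bool) (t : Fin W') :
    bF N t (l1 N W W' y) = bbit (col y) (stride N) t := by
  have key := bbit_iff (stride N) (col_le y) (lt_two_pow_stride N) (stride_pos N) (t : ℕ)
  unfold bF
  rw [← Bool.coe_iff_coe, key]
  simp only [decide_eq_true_eq, termF_l1]
  constructor
  · rintro ⟨⟨j, hj1, hjw⟩, hg, hp⟩
    refine ⟨j, hj1, hjw, hg, fun i hi hij => ?_⟩
    have hiW : i < W' + 1 := lt_trans hij j.2
    exact hp ⟨⟨i, hiW⟩, hi, hij⟩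
  · rintro ⟨j, hj1, hjw, hg, hp⟩
    have hjW : j < W' + 1 := by
      have h1 : j ≤ j * stride N := Nat.le_mul_of_pos_right _ (stride_pos N)
      have h2 := t.2
      omega
    refine ⟨⟨⟨j, hjW⟩, hj1, hjw⟩, hg, ?_⟩
    rintro ⟨⟨i, hiW⟩, hi, hij⟩
    exact hp i hi hij

/-- **Semantics of the output formula**: bit `t` of the total is `qF t ⊕ bF t`. [folklore] -/
theorem testBit_total_eq {N W W' : ℕ} (y : Fin N × Fin W → Bool) (t : Fin W') :
    (total y).testBit t = (qF N t (l1 N W W' y) ^^ bF N t (l1 N W W' y)) := by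
  rw [← pre_col_of_le y (show W ≤ W + t + 1 by omega),
    testBit_pre (d := col y) (show (t : ℕ) < W + t + 1 by omega),
    carry_eq (stride N) (col_le y) (lt_two_pow_stride N), qF_l1, bF_l1]
  cases bbit (col y) (stride N) t
  · simp only [Bool.toNat_false, add_zero, Bool.xor_false]
  · simp only [Bool.toNat_true, Bool.xor_true]
    by_cases hc : (window (col y) (stride N) t / 2 ^ stride N + col y t) % 2 = 1
    · rw [decide_eq_true hc, Bool.not_true, decide_eq_false]; omega
    · rw [decide_eq_false hc, Bool.not_false, decide_eq_true]; omega

end LookAhead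

/-! #### Assembly -/

section Assembly

/-- Size of a pair block. [folklore] -/
def pairBlk (N : ℕ) : ℕ := R N * R N * 1 + 1

/-- Size of one look-ahead term (`∧` of `≤ W' + 2` pair blocks). [folklore] -/
def termBlk (N W' : ℕ) : ℕ := (W' + 2) * pairBlk N + 1

/-- Size of the look-ahead formula `bF` (`∨` of `≤ W' + 1` terms). [folklore] -/
def bBlk (N W' : ℕ) : ℕ := (W' + 1) * termBlk N W' + 1

/-- Size of one output bit formula. [folklore] -/
def bitBlk (N W' : ℕ) : ℕ := 2 * (2 * (bBlk N W' + pairBlk N + 1) + 1) + 1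

/-- **Total size of the iterated-addition circuit** (first layer plus `W'` output formulas). [folklore] -/
def itAddSize (N W' : ℕ) : ℕ := Fintype.card (Bool × Fin W' × Fin (R N)) * l1Blk N + W' * bitBlk N W'

/-- Realization of a pair block. [folklore] -/
theorem acRealOver_pairF {N W' : ℕ} (P : ℕ → ℕ → Prop)
    [DecidablePred fun pr : Fin (R N) × Fin (R N) => P pr.1 pr.2]
    (a b : Fin (R N) → Bool × Fin W' × Fin (R N)) :
    ACRealOver tcBasis (fun z : Bool × Fin W' × Fin (R N) → Bool =>
      decide (∃ pr : {pr : Fin (R N) × Fin (R N) // P pr.1 pr.2},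
        z (a pr.1.1) = true ∧ z (b pr.1.2) = true)) 2 (pairBlk N) := by
  refine (acRealOver_exists_and₂ acBasis_subset_tcBasis
    (fun pr : {pr : Fin (R N) × Fin (R N) // P pr.1 pr.2} => a pr.1.1) (fun pr => b pr.1.2)).mono
    le_rfl ?_
  unfold pairBlk
  have : Fintype.card {pr : Fin (R N) × Fin (R N) // P pr.1 pr.2} ≤ R N * R N :=
    (Fintype.card_subtype_le _).trans (by simp)
  nlinarith

/-- Realization of `gF`. [folklore] -/
theorem acRealOver_gF (N : ℕ) {W' : ℕ} (t : Fin W') (j : ℕ) : ACRealOver tcBasis (gF N t j) 2 (pairBlk N) :=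
  acRealOver_pairF (genP N) (fun α => (false, pos N t j, α)) (fun α' => (false, pos N t (j - 1), α'))

/-- Realization of `pF`. [folklore] -/
theorem acRealOver_pF (N : ℕ) {W' : ℕ} (t : Fin W') (i : ℕ) : ACRealOver tcBasis (pF N t i) 2 (pairBlk N) :=
  acRealOver_pairF (propP N) (fun α => (false, pos N t i, α)) (fun α' => (false, pos N t (i - 1), α'))

/-- Realization of `qF`. [folklore] -/
theorem acRealOver_qF (N : ℕ) {W' : ℕ} (t : Fin W') : ACRealOver tcBasis (qF N t) 2 (pairBlk N) :=
  acRealOver_pairF (parP N) (fun α => (false, t, α)) (fun c => (true, t, c))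

/-- Realization of the look-ahead formula `bF`: depth `4`. [folklore] -/
theorem acRealOver_bF (N : ℕ) {W' : ℕ} (t : Fin W') : ACRealOver tcBasis (bF N t) 4 (bBlk N W') := by
  have hterm : ∀ j : JT N t, ACRealOver tcBasis
      (fun z => decide (∀ o : Option (IT j.1), termF N t j.1 o z = true)) 3 (termBlk N W') := by
    intro j
    have hblk : ∀ o : Option (IT j.1), ACRealOver tcBasis (termF N t j.1 o) 2 (pairBlk N) := by
      rintro (_ | i)
      · exact acRealOver_gF N t j.1
      · exact acRealOver_pF N t i.1
    refine (acRealOver_forall_fintype acBasis_subset_tcBasis hblk).mono le_rfl ?_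
    unfold termBlk
    exact Nat.succ_le_succ (Nat.mul_le_mul_right _ (card_option_IT_le j.1))
  refine (acRealOver_exists_fintype acBasis_subset_tcBasis hterm).mono le_rfl ?_
  unfold bBlk
  exact Nat.succ_le_succ (Nat.mul_le_mul_right _ (card_JT_le N t))

/-- Realization of one output bit formula: depth `6`. [folklore] -/
theorem acRealOver_bitF (N : ℕ) {W' : ℕ} (t : Fin W') :
    ACRealOver tcBasis (fun z => (qF N t z ^^ bF N t z)) 6 (bitBlk N W') := by
  have hq : ACRealOver tcBasis (qF N t) 4 (bBlk N W' + pairBlk N) :=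
    (acRealOver_qF N t).mono (by norm_num) (Nat.le_add_left _ _)
  have hb : ACRealOver tcBasis (bF N t) 4 (bBlk N W' + pairBlk N) :=
    (acRealOver_bF N t).mono le_rfl (Nat.le_add_right _ _)
  exact (hq.xor acBasis_subset_tcBasis not_mem_tcBasis hb).mono le_rfl le_rfl

/-- **Iterated addition in `TC⁰`.** Over the input variables `Fin N × Fin W` (the bit `t` of the
`i`-th number at `(i, t)`), the map sending the inputs to the bits `t < W'` of the SUM of the `N`
numbers is realized over `tcBasis` at depth `9` with `itAddSize N W'` gates (a polynomial in
`N, W'`); the statement is `ITADD ≤cd MAJ` / `ITADD ∈ FTC⁰`, the proof the stride-`w` carry look-ahead of this file. [cite: Vollmer1999, Thm. 1.37 (§1.4.1, PDF p. 57) and §5.3.3 (PDF p. 236)] -/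
theorem acVecOver_iteratedAdd (N W W' : ℕ) :
    ACVecOver tcBasis (fun (y : Fin N × Fin W → Bool) (t : Fin W') => (total y).testBit t) 9
      (itAddSize N W') := by
  have hout : ACVecOver tcBasis (fun (z : Bool × Fin W' × Fin (R N) → Bool) (t : Fin W') =>
      (qF N t z ^^ bF N t z)) 6 (W' * bitBlk N W') := by
    simpa using acVecOver_ofBlocks_fintype_const (κ := Fin W') fun t => acRealOver_bitF N t
  have h := hout.comp (acVecOver_l1 N W W')
  refine (h.congr fun y t => (testBit_total_eq y t).symm).mono le_rfl ?_
  unfold itAddSize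
  omega

/-- **Iterated addition over a shared layer**: if the bits `X x (i, t)` of `N` numbers are the
output wires of a realized layer of depth `d` and size `s`, then the bits `t < W'` of their sum are
realized at depth `d + 9` with `s + itAddSize N W'` gates. [cite: Vollmer1999, Thm. 1.37 (§1.4.1) and §1.2 (composition)] -/
theorem _root_.Literature.Computability.Complexity.ACVecOver.iteratedAdd {ι : Type*} {N W : ℕ}
    {X : (ι → Bool) → Fin N × Fin W → Bool} {d s : ℕ} (hX : ACVecOver tcBasis X d s) (W' : ℕ) :
    ACVecOver tcBasis (fun x (t : Fin W') => (total (X x)).testBit t) (9 + d) (itAddSize N W' + s) :=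
  (acVecOver_iteratedAdd N W W').comp hX

/-- The value computed: `total y = ∑ᵢ ∑_t [y (i,t)] 2^t`, restated. [folklore] -/
theorem total_eq {N W : ℕ} (y : Fin N × Fin W → Bool) :
    total y = ∑ i : Fin N, ∑ t : Fin W, (y (i, t)).toNat * 2 ^ (t : ℕ) := rfl

end Assembly

end Circuit

end ItAdd

end Literature.Computability.Complexity
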